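import Summits.CriticalPhenomena.CardyFormulaZ2.Theorems.CardyUSTContinuationKirchhoffExtremalLengthG02Cross1
import Summits.CriticalPhenomena.CardyFormulaZ2.Theorems.CardyUSTContinuationKirchhoffExtremalLengthG02Dual6
import Literature.Probability.RandomPlanarGeometry.ExteriorULC

/-!
# Exits of the face component near a boundary point, and the exterior ULC radius
# ([GP19] §3 for the `meshDomain` / `discreteArc` discretisation)

Support file for `KirchhoffExtremalLength` (route CardyUSTContinuation of `CardyFormulaZ2`, item
stmt-CriticalPhenomena-11234), towards the upper half of `G02ModulusConvergence` (`…Defs.lean`).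
Two inputs of the boundary-value analysis of the discrete conjugates `facePot` of the potentials
of `Ω_δ = discreteDomainGraph Ω δ`:

* `exists_exit_near'`: from a face `x₀` of the component of the base face whose mesh point is
  within `R₀` of a boundary point `q`, there is an exit `(p₁, n₁)` of the component with both
  squares within `R₀ + 4δ` of `q`, the outer one containing a frontier point (transposition of
  `SquareTiling.exists_exit_near`; here the shadowed segment ends at an EXTERIOR point next to
  `q`, since for `Ω_δ` only squares containing exterior points are known not to be inner faces);
* `exists_ulc_radius`: the form in which the uniform local connectedness of the exterior of a
  Jordan domain (`JordanDomain.exterior_joinedIn_of_dist_lt`) enters the exit-value comparison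
  `faceExitVal_eq_faceExitVal` / `abs_facePot_sub_faceExitVal_le` (their hypothesis `hulc`).
-/

noncomputable section

namespace Summit.CriticalPhenomena.CardyFormulaZ2.Theorems

namespace KirchhoffSlope

open Set Metric Filter Topology SimpleGraph
open Literature.Probability Literature.Probability.LatticeModels Literature.Probability.Percolation
open Literature.Probability.LatticeModels.SquareTiling (walkFlux closedSq floorSq mem_closedSq_floorSq
  meshPoint_mem_closedSq dist_le_of_mem_closedSq exists_dualWalk_of_path near_of_shadow lineMap_props)
open Literature.Probability.RandomPlanarGeometry

variable {δ : ℝ}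

/-! ### Exits near a boundary point -/

/-- **An exit near a boundary point.** From a face `x₀` of the component of the base face `p₀`
whose mesh point is within `R₀` of a boundary point `q`, following the shadow of the segment to an
exterior point next to `q` gives an exit `(p₁, n₁)` of the component whose two squares lie within
`R₀ + 4δ` of `q`, the outer one containing a frontier point. [folklore] -/
theorem exists_exit_near' (R : ConformalRectangle) (hδ : 0 < δ) {p₀ x₀ : Site 2}
    (hp₀ : IsInnerFace R.carrier δ p₀) (hx₀ : (faceGraph R.carrier δ).Reachable p₀ x₀) {q : ℂ}
    (hq : q ∈ frontier R.carrier) {R₀ : ℝ} (hR₀ : dist (meshPoint δ x₀) q ≤ R₀) :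
    ∃ p₁ n₁ : Site 2, (faceGraph R.carrier δ).Reachable p₀ p₁ ∧ (zdGraph 2).Adj p₁ n₁ ∧
      ¬ (faceGraph R.carrier δ).Reachable p₀ n₁ ∧
      (∃ j ∈ closedSq δ n₁, j ∈ frontier R.carrier) ∧
      (∀ w ∈ closedSq δ p₁, dist w q ≤ R₀ + 4 * δ) ∧ (∀ w ∈ closedSq δ n₁, dist w q ≤ R₀ + 4 * δ) := by
  -- an exterior point next to `q`
  obtain ⟨e, he, hqe⟩ := Metric.mem_closure_iff.1 (R.frontier_subset_closure_exterior' hq) δ hδ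
  -- the shadow of the segment from the mesh point of `x₀` to `e`
  obtain ⟨hLc, hL0, hL1, hLim⟩ := lineMap_props (meshPoint δ x₀) e
  obtain ⟨ω, -, hωs⟩ := exists_dualWalk_of_path hδ zero_le_one hLc (P := x₀) (P' := floorSq δ e)
    (by show AffineMap.lineMap _ _ (0 : ℝ) ∈ _; rw [hL0]; exact meshPoint_mem_closedSq hδ.le (Or.inl rfl) (Or.inl rfl))
    (by show AffineMap.lineMap _ _ (1 : ℝ) ∈ _; rw [hL1]; exact mem_closedSq_floorSq hδ _)
  have hreach_inner : ∀ {y : Site 2}, (faceGraph R.carrier δ).Reachable p₀ y → IsInnerFace R.carrier δ y := fun hy => by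
    obtain ⟨W⟩ := hy; exact isInnerFace_of_mem_support' hp₀ W (Walk.end_mem_support _)
  have hend : ¬ (faceGraph R.carrier δ).Reachable p₀ (floorSq δ e) := fun h =>
    not_isInnerFace_of_mem_closedSq R hδ (mem_closedSq_floorSq hδ e) he (hreach_inner h)
  obtain ⟨p₁, n₁, hadj, w₁, w₂, -, hw₁F, hn₁F, hn₁supp, hw₁supp⟩ := exists_exit_decomp ω hx₀ hend
  have hp₁F : (faceGraph R.carrier δ).Reachable p₀ p₁ := hw₁F _ (Walk.end_mem_support _)
  have hnear : ∀ y ∈ ω.support, ∀ w ∈ closedSq δ y, dist w q ≤ R₀ + 4 * δ := by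
    intro y hy w hw
    obtain ⟨v, hv, hvy⟩ := near_of_shadow hωs hy
    rw [hLim] at hv
    have h1 : dist v q ≤ R₀ + δ := by
      have hsub := (convex_closedBall q (R₀ + δ)).segment_subset
        (mem_closedBall.2 (by linarith : dist (meshPoint δ x₀) q ≤ R₀ + δ))
        (mem_closedBall.2 (by rw [_root_.dist_comm]; linarith [hqe.le, dist_nonneg (x := meshPoint δ x₀) (y := q)])) hv
      exact mem_closedBall.1 hsub
    have h2 := dist_le_of_mem_closedSq hw hvy
    linarith [dist_triangle w v q]
  refine ⟨p₁, n₁, hp₁F, hadj, hn₁F, ?_, hnear p₁ (hw₁supp _ (Walk.end_mem_support _)), hnear n₁ hn₁supp⟩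
  exact exists_mem_frontier_of_adj_not_isInnerFace R hδ (hreach_inner hp₁F) hadj fun hI =>
    hn₁F (hp₁F.trans (faceGraph_adj_iff.2 ⟨hadj, hreach_inner hp₁F, hI⟩).reachable)

/-! ### The exterior ULC radius -/

/-- **The exterior ULC radius.** For every `ρ > 0` there is `r_a ∈ (0, ρ/16]` such that for all
meshes `δ ≤ r_a` and every point `q`, any two exterior points within `r_a + 3δ` of `q` are joined
by an exterior path inside `B(q, ρ - 4δ)` (uniform local connectedness of the exterior of the
Jordan curve, `JordanDomain.exterior_joinedIn_of_dist_lt`). This is the hypothesis `hulc` of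
`abs_facePot_sub_faceExitVal_le`, and yields the connecting walks of `faceExitVal_eq_faceExitVal`
through `exists_fluxFree_walk`. [folklore] -/
theorem exists_ulc_radius (R : ConformalRectangle) {ρ : ℝ} (hρ : 0 < ρ) :
    ∃ ra > 0, ra ≤ ρ / 16 ∧ ∀ ⦃δ : ℝ⦄, 0 < δ → δ ≤ ra → ∀ (q e₁ e₂ : ℂ),
      e₁ ∈ (closure R.carrier)ᶜ → e₂ ∈ (closure R.carrier)ᶜ →
      dist e₁ q < ra + 3 * δ → dist e₂ q < ra + 3 * δ →
      JoinedIn ((closure R.carrier)ᶜ ∩ ball q (ρ - 4 * δ)) e₁ e₂ := by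
  obtain ⟨η, hη, hulc⟩ := R.toJordanDomain.exterior_joinedIn_of_dist_lt (ε := ρ / 4) (by positivity)
  refine ⟨min (η / 8) (ρ / 16), by positivity, min_le_right _ _, fun δ hδ hδra q e₁ e₂ he₁ he₂ h₁ h₂ => ?_⟩
  have hη' : min (η / 8) (ρ / 16) ≤ η / 8 := min_le_left _ _
  have hρ' : min (η / 8) (ρ / 16) ≤ ρ / 16 := min_le_right _ _
  have h12 : dist e₁ e₂ < η := by
    have := dist_triangle e₁ q e₂
    rw [_root_.dist_comm q e₂] at this
    linarith
  refine (hulc e₁ he₁ e₂ he₂ h12).mono (inter_subset_inter_right _ (fun z hz => ?_))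
  rw [Metric.mem_ball] at hz ⊢
  linarith [dist_triangle z e₁ q]

/-- **Flux-free connections between exits near one boundary point.** For the mesh and radius of
`exists_ulc_radius`: the outer squares of two exits `(p, p')`, `(q₁, q₁')` of inner faces that
contain points within `r_a` of a point `q` are joined by a lattice walk carrying no flux of the
current of `h`, all of whose squares contain a point within `ρ - 4δ` of `q`. [folklore] -/
theorem exists_fluxFree_walk_near (R : ConformalRectangle) (hδ : 0 < δ) (h : Site 2 → ℝ) {q : ℂ} {ra ρ : ℝ}
    (hraρ : ra ≤ ρ / 16) (hδra : δ ≤ ra)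
    (hulc : ∀ e₁ e₂ : ℂ, e₁ ∈ (closure R.carrier)ᶜ → e₂ ∈ (closure R.carrier)ᶜ →
      dist e₁ q < ra + 3 * δ → dist e₂ q < ra + 3 * δ →
      JoinedIn ((closure R.carrier)ᶜ ∩ ball q (ρ - 4 * δ)) e₁ e₂)
    {p p' q₁ q₁' : Site 2} (hp : IsInnerFace R.carrier δ p) (hpp' : (zdGraph 2).Adj p p')
    (hp' : ¬ IsInnerFace R.carrier δ p') (hq₁ : IsInnerFace R.carrier δ q₁) (hqq' : (zdGraph 2).Adj q₁ q₁')
    (hq₁' : ¬ IsInnerFace R.carrier δ q₁')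
    (hnp : ∃ w ∈ closedSq δ p', dist w q < ra) (hnq : ∃ w ∈ closedSq δ q₁', dist w q < ra) :
    ∃ ω : (zdGraph 2).Walk p' q₁', walkFlux (ecurH R.carrier δ h) (ecurV R.carrier δ h) ω = 0 ∧
      ∀ Q ∈ ω.support, ∃ w ∈ closedSq δ Q, dist w q < ρ - 4 * δ := by
  obtain ⟨ω, hω0, hωs⟩ := exists_fluxFree_walk R hδ h (qa := q) (qb := q) (r := ra) (S := ball q (ρ - 4 * δ))
    (fun e₁ e₂ he₁ he₂ h₁ h₂ => hulc e₁ e₂ he₁ he₂ h₁ h₂) hp hpp' hp' hq₁ hqq' hq₁' hnp hnq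
  refine ⟨ω, hω0, fun Q hQ => ?_⟩
  obtain ⟨w, hw, hw'⟩ := hωs Q hQ
  refine ⟨w, hw, ?_⟩
  rcases hw' with h' | h' | h'
  · exact Metric.mem_ball.1 h'
  · linarith
  · linarith

end KirchhoffSlope

end Summit.CriticalPhenomena.CardyFormulaZ2.Theorems
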